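import Mathlib
import Literature.Analysis.ODE.SchrodingerODE
import Literature.Analysis.ODE.VariationOfParametersTail
import HarnessLib

/-!
# The recessive solution at `+∞` of `u'' = (ℓ(ℓ+1)/x² + W(x)) u` for a short-range tail `W`
# (Volterra method around `x^{-ℓ}`)

Analysis/ODE support file (everything proved, no definitions). Let `V, W : ℝ → ℝ` be continuous,
`ℓ : ℕ`, `x₀ ≥ 1`, with `V x = ℓ(ℓ+1)/x² + W x` for `x ≥ x₀` and the tail small in the Volterra sense:
`y ↦ y |W y|` integrable on `(x₀, ∞)` with `∫_{x₀}^∞ y |W y| dy ≤ 1/8`. Then the integral equation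
(variation of constants around the exact recessive solution `x^{-ℓ}` of `φ'' = ℓ(ℓ+1)x⁻²φ`, Green
kernel `(x^{ℓ+1} y^{-ℓ} − x^{-ℓ} y^{ℓ+1})/(2ℓ+1)`)

  `u(x) = x^{-ℓ} (1 + c ∫_x^∞ y^{ℓ+1} W u) − c x^{ℓ+1} ∫_x^∞ y^{-ℓ} W u`,   `c = 1/(2ℓ+1)`,

has a solution on `(x₀, ∞)` which extends to a GLOBAL classical solution `U` of `U'' = V U`
(`IsSchrodingerSol V U`, `SchrodingerODE.lean`) with, for `x > x₀` and `Q(x) := ∫_x^∞ y|W y| dy`,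

  `|x^ℓ U(x) − 1| ≤ 3 Q(x)`  and  `|U'(x) + ℓ x^{-ℓ-1}| ≤ 2 Q(x) x^{-ℓ-1}`

(`exists_isSchrodingerSol_recessive_inverseSquare`): the solution RECESSIVE at `+∞` (`U ~ x^{-ℓ}`,
positive beyond `x₀`). Classical (Volterra series / Jost solutions for `∫ y|W| < ∞`, e.g. P. Hartman,
*Ordinary Differential Equations*, Ch. XI §9; Reed–Simon III, Thm. XI.57); proof: a contraction on
bounded continuous functions for `v = x^ℓ u` (operator frozen at `x₀`), the variation-of-parameters
differentiation rules of `VariationOfParametersTail.lean`, and global continuation by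
`exists_isSchrodingerSol` + uniqueness of the phase curve on `(x₀, b)`. Use: static top coefficients
of the true t-polynomial kernel on the null-infinity side of the Regge–Wheeler channel estimate
`FixedModeChannels` (route PhotonSphereChannels, stmt-FinalStateConjecture-10048), where
`W = O(x⁻³ log x)`; for `ℓ = 0` the recessive solution tends to `1`.
-/

noncomputable section

namespace Literature.Analysis.ODE

open MeasureTheory Set Filter Topology intervalIntegral BoundedContinuousFunction

section Volterra

variable {V W : ℝ → ℝ} {x₀ : ℝ}

/-- **The recessive solution at `+∞` (global form).** See the module docstring. [folklore] -/
theorem exists_isSchrodingerSol_recessive_inverseSquare (hV : Continuous V) (hW : Continuous W)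
    (hx₀ : 1 ≤ x₀) (ℓ : ℕ) (hVW : ∀ x, x₀ ≤ x → V x = (ℓ : ℝ) * (ℓ + 1) / x ^ 2 + W x)
    (hWi : IntegrableOn (fun y => y * |W y|) (Ioi x₀))
    (hQ : ∫ y in Ioi x₀, y * |W y| ≤ 1 / 8) :
    ∃ U : ℝ → ℝ, IsSchrodingerSol V U ∧
      (∀ x, x₀ < x → |x ^ ℓ * U x - 1| ≤ 3 * ∫ y in Ioi x, y * |W y|) ∧
      (∀ x, x₀ < x → |deriv U x + ℓ * x ^ (-(ℓ : ℤ) - 1)|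
        ≤ 2 * (∫ y in Ioi x, y * |W y|) * x ^ (-(ℓ : ℤ) - 1)) := by
  -- the tail functional `Qz z = ∫_z^∞ y|W|`
  set Qz : ℝ → ℝ := fun z => ∫ y in Ioi z, y * |W y| with hQz
  have hnn : ∀ z, x₀ ≤ z → ∀ y ∈ Ioi z, 0 ≤ y * |W y| := fun z hz y hy =>
    mul_nonneg (by linarith [mem_Ioi.1 hy]) (abs_nonneg _)
  have hQz_nonneg : ∀ z, x₀ ≤ z → 0 ≤ Qz z := fun z hz =>
    setIntegral_nonneg measurableSet_Ioi (hnn z hz)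
  have hQz_le : ∀ z, x₀ ≤ z → Qz z ≤ Qz x₀ := fun z hz =>
    setIntegral_mono_set hWi (ae_restrict_of_forall_mem measurableSet_Ioi (hnn x₀ le_rfl))
      (ae_of_all _ (Ioi_subset_Ioi hz))
  set Q : ℝ := Qz x₀ with hQdef
  have hQ0 : 0 ≤ Q := hQz_nonneg x₀ le_rfl
  have hQ8 : Q ≤ 1 / 8 := hQ
  -- constants and the frozen point
  set c : ℝ := 1 / (2 * (ℓ : ℝ) + 1) with hc
  have hc0 : 0 < c := by positivity
  have hc1 : c ≤ 1 := by
    rw [hc, div_le_one (by positivity)]; linarith [(Nat.cast_nonneg ℓ : (0 : ℝ) ≤ ℓ)]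
  set m : ℝ → ℝ := fun x => max x x₀ with hm
  have hm_ge : ∀ x, x₀ ≤ m x := fun x => le_max_right _ _
  have hm_cont : Continuous m := continuous_id.max continuous_const
  -- the kernels and the Volterra operator
  set k₁ : (ℝ → ℝ) → ℝ → ℝ := fun f y => W y * f y / (max y 1) ^ (2 * ℓ) with hk₁
  set k₂ : (ℝ → ℝ) → ℝ → ℝ := fun f y => y * W y * f y with hk₂
  have hk₁c : ∀ {f : ℝ → ℝ}, Continuous f → Continuous (k₁ f) := fun hf =>
    (hW.mul hf).div ((continuous_id.max continuous_const).pow _) fun y =>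
      pow_ne_zero _ (lt_max_of_lt_right one_pos).ne'
  have hk₂c : ∀ {f : ℝ → ℝ}, Continuous f → Continuous (k₂ f) := fun hf =>
    (continuous_id.mul hW).mul hf
  set Top : (ℝ → ℝ) → ℝ → ℝ := fun f x =>
    1 + c * (∫ y in Ioi (m x), k₂ f y) - c * ((m x) ^ (2 * ℓ + 1) * ∫ y in Ioi (m x), k₁ f y)
    with hTop
  -- tail bounds for the two kernels
  have hB₂ : ∀ {f : ℝ → ℝ}, Continuous f → ∀ C, (∀ y, |f y| ≤ C) → ∀ z, x₀ ≤ z →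
      IntegrableOn (k₂ f) (Ioi z) ∧ |∫ y in Ioi z, k₂ f y| ≤ C * Qz z :=
    fun hf C hC z hz => abs_setIntegral_Ioi_mul_le hW hx₀ hWi hf hC hz
  have hB₁ : ∀ {f : ℝ → ℝ}, Continuous f → ∀ C, (∀ y, |f y| ≤ C) → ∀ z, x₀ ≤ z →
      IntegrableOn (k₁ f) (Ioi z) ∧ z ^ (2 * ℓ + 1) * |∫ y in Ioi z, k₁ f y| ≤ C * Qz z :=
    fun hf C hC z hz => abs_setIntegral_Ioi_div_pow_le hW hx₀ hWi hf hC ℓ hz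
  -- continuity of `x ↦ ∫_{Ioi (m x)} k`
  have hprim : ∀ {k : ℝ → ℝ}, Continuous k → IntegrableOn k (Ioi x₀) →
      Continuous fun x => ∫ y in Ioi (m x), k y := by
    intro k hk hki
    have heq : (fun x => ∫ y in Ioi (m x), k y)
        = fun x => (∫ y in Ioi x₀, k y) - ∫ y in x₀..(m x), k y := by
      funext x
      have := intervalIntegral.integral_Ioi_sub_Ioi hki (hm_ge x)
      linarith
    rw [heq]
    exact continuous_const.sub ((intervalIntegral.continuous_primitive
      (fun a b => hk.intervalIntegrable a b) x₀).comp hm_cont)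
  have hTop_cont : ∀ {f : ℝ → ℝ}, Continuous f → ∀ C, (∀ y, |f y| ≤ C) → Continuous (Top f) := by
    intro f hf C hC
    refine (continuous_const.add (continuous_const.mul (hprim (hk₂c hf) ?_))).sub
      (continuous_const.mul ((hm_cont.pow _).mul (hprim (hk₁c hf) ?_)))
    · exact (hB₂ hf C hC x₀ le_rfl).1
    · exact (hB₁ hf C hC x₀ le_rfl).1
  have hTop_bound : ∀ {f : ℝ → ℝ}, Continuous f → ∀ C, (∀ y, |f y| ≤ C) → ∀ x,
      |Top f x - 1| ≤ 2 * C * Qz (m x) := by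
    intro f hf C hC x
    have h2 := (hB₂ hf C hC (m x) (hm_ge x)).2
    have h1 := (hB₁ hf C hC (m x) (hm_ge x)).2
    have hmp : 0 ≤ (m x) ^ (2 * ℓ + 1) := pow_nonneg (by linarith [hm_ge x]) _
    have e : Top f x - 1 = c * ((∫ y in Ioi (m x), k₂ f y)
        - (m x) ^ (2 * ℓ + 1) * ∫ y in Ioi (m x), k₁ f y) := by
      simp only [hTop]; ring
    rw [e, abs_mul, abs_of_pos hc0]
    calc c * |(∫ y in Ioi (m x), k₂ f y) - (m x) ^ (2 * ℓ + 1) * ∫ y in Ioi (m x), k₁ f y|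
        ≤ 1 * (|∫ y in Ioi (m x), k₂ f y| + |(m x) ^ (2 * ℓ + 1) * ∫ y in Ioi (m x), k₁ f y|) := by
          gcongr; exact abs_sub _ _
      _ = |∫ y in Ioi (m x), k₂ f y| + (m x) ^ (2 * ℓ + 1) * |∫ y in Ioi (m x), k₁ f y| := by
          rw [one_mul, abs_mul, abs_of_nonneg hmp]
      _ ≤ C * Qz (m x) + C * Qz (m x) := add_le_add h2 h1
      _ = 2 * C * Qz (m x) := by ring
  -- the operator on bounded continuous functions
  have hnorm_abs : ∀ (f : ℝ →ᵇ ℝ) (y : ℝ), |f y| ≤ ‖f‖ := fun f y => by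
    rw [← Real.norm_eq_abs]; exact f.norm_coe_le_norm y
  have hT_bd : ∀ f : ℝ →ᵇ ℝ, ∀ x, ‖Top f x‖ ≤ 1 + ‖f‖ * (2 * Q) := fun f x => by
    have h := hTop_bound f.continuous ‖f‖ (hnorm_abs f) x
    have hQm : Qz (m x) ≤ Q := hQz_le _ (hm_ge x)
    rw [Real.norm_eq_abs]
    have : |Top f x| ≤ |Top f x - 1| + |(1 : ℝ)| := by
      have := abs_add_le (Top f x - 1) 1; simpa only [sub_add_cancel] using this
    rw [abs_one] at this
    nlinarith [norm_nonneg f]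
  set T : (ℝ →ᵇ ℝ) → (ℝ →ᵇ ℝ) := fun f =>
    BoundedContinuousFunction.ofNormedAddCommGroup (Top f)
      (hTop_cont f.continuous ‖f‖ (hnorm_abs f)) (1 + ‖f‖ * (2 * Q)) (hT_bd f) with hT
  have hT_apply : ∀ (f : ℝ →ᵇ ℝ) (x : ℝ), T f x = Top f x := fun f x => rfl
  have hT_norm : ∀ f : ℝ →ᵇ ℝ, ‖T f‖ ≤ 1 + ‖f‖ * (2 * Q) := fun f =>
    BoundedContinuousFunction.norm_ofNormedAddCommGroup_le _
      (add_nonneg zero_le_one (mul_nonneg (norm_nonneg _) (by positivity))) _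
  have h2Q0 : 0 ≤ 2 * Q := by positivity
  have h2Q1 : 2 * Q < 1 := by linarith
  have hK : (((2 * Q).toNNReal : NNReal) : ℝ) = 2 * Q := Real.coe_toNNReal _ h2Q0
  have hT_contr : ContractingWith (2 * Q).toNNReal T := by
    refine ⟨NNReal.coe_lt_coe.1 (by rw [hK, NNReal.coe_one]; exact h2Q1),
      LipschitzWith.of_dist_le_mul fun f g => ?_⟩
    rw [hK, dist_le (mul_nonneg h2Q0 dist_nonneg)]
    intro x
    rw [hT_apply, hT_apply, Real.dist_eq]
    have hφ : Continuous fun y => f y - g y := f.continuous.sub g.continuous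
    have hCd : ∀ y, |f y - g y| ≤ dist f g := fun y => by
      rw [← Real.dist_eq]; exact dist_coe_le_dist y
    obtain ⟨i2f, -⟩ := hB₂ f.continuous ‖f‖ (hnorm_abs f) (m x) (hm_ge x)
    obtain ⟨i2g, -⟩ := hB₂ g.continuous ‖g‖ (hnorm_abs g) (m x) (hm_ge x)
    obtain ⟨i1f, -⟩ := hB₁ f.continuous ‖f‖ (hnorm_abs f) (m x) (hm_ge x)
    obtain ⟨i1g, -⟩ := hB₁ g.continuous ‖g‖ (hnorm_abs g) (m x) (hm_ge x)
    obtain ⟨-, b2⟩ := hB₂ hφ (dist f g) hCd (m x) (hm_ge x)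
    obtain ⟨-, b1⟩ := hB₁ hφ (dist f g) hCd (m x) (hm_ge x)
    have hmp : 0 ≤ (m x) ^ (2 * ℓ + 1) := pow_nonneg (by linarith [hm_ge x]) _
    have e2 : (∫ y in Ioi (m x), k₂ f y) - (∫ y in Ioi (m x), k₂ g y)
        = ∫ y in Ioi (m x), k₂ (fun y => f y - g y) y := by
      rw [← integral_sub i2f i2g]
      refine integral_congr_ae (Eventually.of_forall fun y => ?_)
      simp only [hk₂]; ring
    have e1 : (∫ y in Ioi (m x), k₁ f y) - (∫ y in Ioi (m x), k₁ g y)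
        = ∫ y in Ioi (m x), k₁ (fun y => f y - g y) y := by
      rw [← integral_sub i1f i1g]
      refine integral_congr_ae (Eventually.of_forall fun y => ?_)
      simp only [hk₁]; ring
    have hdiff : Top f x - Top g x = c * ((∫ y in Ioi (m x), k₂ (fun y => f y - g y) y)
        - (m x) ^ (2 * ℓ + 1) * ∫ y in Ioi (m x), k₁ (fun y => f y - g y) y) := by
      rw [← e2, ← e1]; simp only [hTop]; ring
    rw [hdiff, abs_mul, abs_of_pos hc0]
    calc c * |(∫ y in Ioi (m x), k₂ (fun y => f y - g y) y)
          - (m x) ^ (2 * ℓ + 1) * ∫ y in Ioi (m x), k₁ (fun y => f y - g y) y|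
        ≤ 1 * (|∫ y in Ioi (m x), k₂ (fun y => f y - g y) y|
          + |(m x) ^ (2 * ℓ + 1) * ∫ y in Ioi (m x), k₁ (fun y => f y - g y) y|) := by
          gcongr; exact abs_sub _ _
      _ = |∫ y in Ioi (m x), k₂ (fun y => f y - g y) y|
          + (m x) ^ (2 * ℓ + 1) * |∫ y in Ioi (m x), k₁ (fun y => f y - g y) y| := by
          rw [one_mul, abs_mul, abs_of_nonneg hmp]
      _ ≤ dist f g * Qz (m x) + dist f g * Qz (m x) := add_le_add b2 b1
      _ ≤ dist f g * Q + dist f g * Q := by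
          have := hQz_le _ (hm_ge x)
          gcongr
      _ = 2 * Q * dist f g := by ring
  -- the fixed point `v` and its bounds
  set v₀ : ℝ →ᵇ ℝ := ContractingWith.fixedPoint T hT_contr with hv₀
  have hfix₀ : T v₀ = v₀ := hT_contr.fixedPoint_isFixedPt
  set v : ℝ → ℝ := fun x => v₀ x with hv
  have hvc : Continuous v := v₀.continuous
  have hfix : ∀ x, v x = Top v x := fun x => by
    have h := congrArg (fun h : ℝ →ᵇ ℝ => h x) hfix₀
    simpa [hT_apply] using h.symm
  have hnorm : ‖v₀‖ ≤ 4 / 3 := by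
    have h := hT_norm v₀
    rw [hfix₀] at h
    nlinarith [norm_nonneg v₀]
  have habs : ∀ y, |v y| ≤ 4 / 3 := fun y => (hnorm_abs v₀ y).trans hnorm
  -- the integral equation on `[x₀, ∞)` and closeness to `1`
  set P₁ : ℝ → ℝ := fun z => ∫ y in Ioi z, k₁ v y with hP₁
  set P₂ : ℝ → ℝ := fun z => ∫ y in Ioi z, k₂ v y with hP₂
  have heq : ∀ x, x₀ ≤ x → v x = 1 + c * P₂ x - c * (x ^ (2 * ℓ + 1) * P₁ x) := by
    intro x hx
    have h := hfix x
    simp only [hTop, hm, max_eq_left hx] at h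
    exact h
  have hP₂b : ∀ x, x₀ ≤ x → |P₂ x| ≤ 4 / 3 * Qz x := fun x hx => (hB₂ hvc _ habs x hx).2
  have hP₁b : ∀ x, x₀ ≤ x → x ^ (2 * ℓ + 1) * |P₁ x| ≤ 4 / 3 * Qz x := fun x hx =>
    (hB₁ hvc _ habs x hx).2
  have hclose : ∀ x, x₀ ≤ x → |v x - 1| ≤ 3 * Qz x := by
    intro x hx
    have h := hTop_bound hvc _ habs x
    rw [← hfix x] at h
    simp only [hm, max_eq_left hx] at h
    linarith [hQz_nonneg x hx]
  -- derivatives of the tail integrals on `(x₀, ∞)`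
  have hFTC : ∀ {k : ℝ → ℝ}, Continuous k → IntegrableOn k (Ioi x₀) → ∀ x, x₀ < x →
      HasDerivAt (fun z => ∫ y in Ioi z, k y) (-k x) x := by
    intro k hk hki x hx
    have hev : (fun z => ∫ y in Ioi z, k y)
        =ᶠ[𝓝 x] fun z => (∫ y in Ioi x₀, k y) - ∫ y in x₀..z, k y := by
      filter_upwards [Ioi_mem_nhds hx] with z hz
      have := intervalIntegral.integral_Ioi_sub_Ioi hki (le_of_lt hz)
      linarith
    refine HasDerivAt.congr_of_eventuallyEq ?_ hev
    have h := (intervalIntegral.integral_hasDerivAt_right (hk.intervalIntegrable x₀ x)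
      (hk.stronglyMeasurableAtFilter volume (𝓝 x)) hk.continuousAt).const_sub (∫ y in Ioi x₀, k y)
    simpa using h
  have hP₁d : ∀ x, x₀ < x → HasDerivAt P₁ (-k₁ v x) x := fun x hx =>
    hFTC (hk₁c hvc) (hB₁ hvc _ habs x₀ le_rfl).1 x hx
  have hP₂d : ∀ x, x₀ < x → HasDerivAt P₂ (-k₂ v x) x := fun x hx =>
    hFTC (hk₂c hvc) (hB₂ hvc _ habs x₀ le_rfl).1 x hx
  -- variation of parameters: `u = φ₁ α + φ₂ β` with `φ₁ = x^{-ℓ}`, `φ₂ = x^{ℓ+1}`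
  set φ₁ : ℝ → ℝ := fun y => y ^ (-(ℓ : ℤ)) with hφ₁
  set φ₂ : ℝ → ℝ := fun y => y ^ ((ℓ : ℤ) + 1) with hφ₂
  set α : ℝ → ℝ := fun y => 1 + c * P₂ y with hα
  set β : ℝ → ℝ := fun y => -c * P₁ y with hβ
  set u : ℝ → ℝ := fun y => y ^ (-(ℓ : ℤ)) * v y with hu
  set G : ℝ → ℝ := fun y => φ₁ y * α y + φ₂ y * β y with hG
  set D : ℝ → ℝ := fun y => deriv φ₁ y * α y + deriv φ₂ y * β y with hD
  set hsrc : ℝ → ℝ := fun y => W y * u y with hhsrc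
  have hx0_of : ∀ {x}, x₀ ≤ x → x ≠ 0 := fun hx => by intro h; rw [h] at hx; linarith
  -- zpow bookkeeping at a point `x ≥ x₀`
  have hz1 : ∀ {x : ℝ}, x ≠ 0 → x ^ (-(ℓ : ℤ)) * x ^ (2 * ℓ + 1) = x ^ ((ℓ : ℤ) + 1) := by
    intro x hx
    rw [← zpow_natCast, ← zpow_add₀ hx]; congr 1; push_cast; ring
  have hz2 : ∀ {x : ℝ}, x ≠ 0 → x ^ ((ℓ : ℤ) + 1) * x ^ (-(ℓ : ℤ)) = x := by
    intro x hx
    rw [← zpow_add₀ hx]; ring_nf; simp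
  have hz3 : ∀ {x : ℝ}, x₀ ≤ x → x ^ (-(ℓ : ℤ)) * x ^ (-(ℓ : ℤ)) = 1 / (max x 1) ^ (2 * ℓ) := by
    intro x hx
    have hx' := hx0_of hx
    rw [max_eq_left (hx₀.trans hx), ← zpow_add₀ hx', one_div, ← zpow_natCast, ← zpow_neg]
    congr 1; push_cast; ring
  have huG : ∀ x, x₀ ≤ x → u x = G x := by
    intro x hx
    have hx' := hx0_of hx
    simp only [hu, hG, hφ₁, hφ₂, hα, hβ]
    rw [heq x hx, ← hz1 hx']
    ring
  have hvG : ∀ x, x₀ ≤ x → x ^ ℓ * G x = v x := by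
    intro x hx
    have hx' := hx0_of hx
    rw [← huG x hx]
    simp only [hu]
    rw [← mul_assoc, ← zpow_natCast, ← zpow_add₀ hx']
    simp
  -- first and second derivatives on `(x₀, ∞)`
  have hGd : ∀ x, x₀ < x → HasDerivAt G (D x) x := by
    intro x hx
    have hx' := hx0_of hx.le
    refine hasDerivAt_varParams (κ := c) (h := hsrc) ?_ ?_ ?_ ?_
    · exact (hasDerivAt_zpow _ x (Or.inl hx')).differentiableAt
    · exact (hasDerivAt_zpow _ x (Or.inl hx')).differentiableAt
    · have h := ((hP₂d x hx).const_mul c).const_add 1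
      refine h.congr_deriv ?_
      simp only [hk₂, hhsrc, hu, hφ₂]
      rw [show c * (x ^ ((ℓ : ℤ) + 1)) * (W x * (x ^ (-(ℓ : ℤ)) * v x))
        = c * (x ^ ((ℓ : ℤ) + 1) * x ^ (-(ℓ : ℤ))) * W x * v x by ring, hz2 hx']
      ring
    · have h := (hP₁d x hx).const_mul (-c)
      refine h.congr_deriv ?_
      simp only [hk₁, hhsrc, hu, hφ₁]
      rw [show c * x ^ (-(ℓ : ℤ)) * (W x * (x ^ (-(ℓ : ℤ)) * v x))
        = c * (x ^ (-(ℓ : ℤ)) * x ^ (-(ℓ : ℤ))) * (W x * v x) by ring, hz3 hx.le]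
      ring
  have hDd : ∀ x, x₀ < x → HasDerivAt D (V x * G x) x := by
    intro x hx
    have hx' := hx0_of hx.le
    have h := hasDerivAt_varParams_deriv (κ := c) (h := hsrc)
      (q := (ℓ : ℝ) * (ℓ + 1) / x ^ 2) (φ₁ := φ₁) (φ₂ := φ₂) (α := α) (β := β) (x := x)
      ?_ ?_ ?_ ?_ ?_
    · refine h.congr_deriv ?_
      have e : hsrc x = W x * G x := by simp only [hhsrc]; rw [huG x hx.le]
      rw [e, hVW x hx.le]
      simp only [hG]
      ring
    · have := hasDerivAt_deriv_zpow (-(ℓ : ℤ)) hx'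
      refine this.congr_deriv ?_
      simp only [hφ₁]; push_cast; ring
    · have := hasDerivAt_deriv_zpow ((ℓ : ℤ) + 1) hx'
      refine this.congr_deriv ?_
      simp only [hφ₂]; push_cast; ring
    · have h := ((hP₂d x hx).const_mul c).const_add 1
      refine h.congr_deriv ?_
      simp only [hk₂, hhsrc, hu, hφ₂]
      rw [show c * (x ^ ((ℓ : ℤ) + 1)) * (W x * (x ^ (-(ℓ : ℤ)) * v x))
        = c * (x ^ ((ℓ : ℤ) + 1) * x ^ (-(ℓ : ℤ))) * W x * v x by ring, hz2 hx']
      ring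
    · have h := (hP₁d x hx).const_mul (-c)
      refine h.congr_deriv ?_
      simp only [hk₁, hhsrc, hu, hφ₁]
      rw [show c * x ^ (-(ℓ : ℤ)) * (W x * (x ^ (-(ℓ : ℤ)) * v x))
        = c * (x ^ (-(ℓ : ℤ)) * x ^ (-(ℓ : ℤ))) * (W x * v x) by ring, hz3 hx.le]
      ring
    · simpa only [hφ₁, hφ₂, hc] using wronskian_zpow ℓ hx'
  -- global continuation through the data at `x₀ + 1`
  obtain ⟨U, hU, hU0, hU1⟩ := exists_isSchrodingerSol hV (x₀ + 1) (G (x₀ + 1)) (D (x₀ + 1))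
  have hEq : ∀ x, x₀ < x → G x = U x ∧ D x = deriv U x := by
    intro x hx
    set b : ℝ := max x (x₀ + 1) + 1 with hb
    have hxb : x < b := by simp only [hb]; linarith [le_max_left x (x₀ + 1)]
    have h1b : x₀ + 1 < b := by simp only [hb]; linarith [le_max_right x (x₀ + 1)]
    obtain ⟨K, -, -, hK⟩ := exists_const_schrodingerField hV x₀ b
    have key := ODE_solution_unique_of_mem_Ioo (v := schrodingerField V) (s := fun _ => univ)
      (K := K) (f := fun s => (G s, D s)) (g := fun s => (U s, deriv U s))
      (a := x₀) (b := b) (t₀ := x₀ + 1)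
      (fun τ hτ => ((hK τ (Ioo_subset_Icc_self hτ)).1).lipschitzOnWith) ⟨by linarith, h1b⟩
      (fun τ hτ => ⟨(hGd τ hτ.1).prodMk (hDd τ hτ.1), mem_univ _⟩)
      (fun τ _ => ⟨hU.hasDerivAt_phase τ, mem_univ _⟩) (by simp [hU0, hU1]) ⟨hx, hxb⟩
    exact ⟨congrArg Prod.fst key, congrArg Prod.snd key⟩
  refine ⟨U, hU, fun x hx => ?_, fun x hx => ?_⟩
  · rw [← (hEq x hx).1, hvG x hx.le]
    exact hclose x hx.le
  · rw [← (hEq x hx).2]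
    have hx' := hx0_of hx.le
    have hxpos : 0 < x := by linarith
    have hQx := hQz_nonneg x hx.le
    -- `D x + ℓ x^{-ℓ-1} = -c (ℓ x^{-ℓ-1} P₂ + (ℓ+1) x^ℓ P₁)`
    have hd1 : deriv φ₁ x = -(ℓ : ℝ) * x ^ (-(ℓ : ℤ) - 1) := by
      simp only [hφ₁]; rw [deriv_zpow]; push_cast; ring
    have hd2 : deriv φ₂ x = ((ℓ : ℝ) + 1) * (x ^ (-(ℓ : ℤ) - 1) * x ^ (2 * ℓ + 1)) := by
      simp only [hφ₂]; rw [deriv_zpow, ← zpow_natCast, ← zpow_add₀ hx']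
      push_cast; ring_nf
    have e : D x + ℓ * x ^ (-(ℓ : ℤ) - 1)
        = -c * (ℓ * x ^ (-(ℓ : ℤ) - 1) * P₂ x
          + (ℓ + 1) * x ^ (-(ℓ : ℤ) - 1) * (x ^ (2 * ℓ + 1) * P₁ x)) := by
      simp only [hD, hα, hβ, hd1, hd2]; ring
    have hzp : 0 < x ^ (-(ℓ : ℤ) - 1) := zpow_pos hxpos _
    rw [e, abs_mul, abs_neg, abs_of_pos hc0]
    calc c * |ℓ * x ^ (-(ℓ : ℤ) - 1) * P₂ x + (ℓ + 1) * x ^ (-(ℓ : ℤ) - 1) * (x ^ (2 * ℓ + 1) * P₁ x)|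
        ≤ c * (|ℓ * x ^ (-(ℓ : ℤ) - 1) * P₂ x| + |(ℓ + 1) * x ^ (-(ℓ : ℤ) - 1) * (x ^ (2 * ℓ + 1) * P₁ x)|) := by
          gcongr; exact abs_add_le _ _
      _ = c * (ℓ * x ^ (-(ℓ : ℤ) - 1) * |P₂ x|
          + (ℓ + 1) * x ^ (-(ℓ : ℤ) - 1) * (x ^ (2 * ℓ + 1) * |P₁ x|)) := by
          rw [abs_mul, abs_mul, abs_mul, abs_mul, abs_mul (x ^ (2 * ℓ + 1)),
            abs_of_nonneg (Nat.cast_nonneg ℓ), abs_of_pos hzp,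
            abs_of_nonneg (by positivity : (0 : ℝ) ≤ ℓ + 1), abs_of_nonneg (pow_nonneg hxpos.le _)]
      _ ≤ c * (ℓ * x ^ (-(ℓ : ℤ) - 1) * (4 / 3 * Qz x)
          + (ℓ + 1) * x ^ (-(ℓ : ℤ) - 1) * (4 / 3 * Qz x)) := by
          have hA : 0 ≤ (ℓ : ℝ) * x ^ (-(ℓ : ℤ) - 1) := by positivity
          have hB : 0 ≤ ((ℓ : ℝ) + 1) * x ^ (-(ℓ : ℤ) - 1) := by positivity
          apply mul_le_mul_of_nonneg_left _ hc0.le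
          exact add_le_add (mul_le_mul_of_nonneg_left (hP₂b x hx.le) hA)
            (mul_le_mul_of_nonneg_left (hP₁b x hx.le) hB)
      _ = 4 / 3 * Qz x * x ^ (-(ℓ : ℤ) - 1) * (c * (2 * ℓ + 1)) := by ring
      _ = 4 / 3 * Qz x * x ^ (-(ℓ : ℤ) - 1) := by
          rw [hc, div_mul_cancel₀ _ (by positivity), mul_one]
      _ ≤ 2 * Qz x * x ^ (-(ℓ : ℤ) - 1) := by gcongr; norm_num

end Volterra

end Literature.Analysis.ODE
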